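import Mathlib
import HarnessLib
import Literature.NumberTheory.DiophantineGeometry.BelyiWitnessExtremal

/-!
# Crux `CompactBalanceTransfer` (stmt-ABC-1725) — tight correspondences send deep families to deep families

Third part of the kernel-checked Lemma NA / O1 of the crux record (line lead `prover-line-stmt-ABC-1725-c5-0`,
line `birth`, 2026-08-17), after `Negative/CorrespondenceToll.lean` (the Mason–Stothers toll: a quality-transferring
correspondence `β = p/q` of degree `d` is TIGHT, `D + 1 ≤ d`, and then `p·q·(p−q)` vanishes at `0` and `1`) and
`Negative/CorrespondenceTollSharp.lean` (Riemann–Hurwitz: `∞` is in the fibre too).  Here the archimedean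
consequence is drawn, in the currency of the crux's hypothesis
`H := ∀ κ > 0, ∀ ε > 0, ∃ C, ∀ abc-triples, κc ≤ a → κc ≤ b → c < C · rad(abc)^(1+ε)`:

the image of the abc-triple `(a, b, c)`, `x = a/c`, under the identity `p + (q − p) = q` is the integer triple
`c^d · (p(x), (q − p)(x), q(x))`, whose BALANCE `min/max` of the three absolute values is
`bal(x) = min(|p x|, |q x − p x|, |q x|) / max(|p x|, |q x − p x|, |q x|)` (for `A′ + B′ = C′` the member of largest
absolute value is the sum of the other two, and `κ`-balance in the sense of `H` is `κ ≤ bal`).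

* `image_balance_tendsto_zero` : if `p·q·(p−q)` vanishes at `0` and `p, q` do not both vanish there, then
  `bal(x) → 0` as `x → 0` — the images of a deep family (`a/c → 0`) form a deep family;
* `image_eventually_unbalanced` : hence for every `κ > 0` the images of all sufficiently deep triples lie OUTSIDE the
  `κ`-balanced cell, i.e. `H` (at any fixed `κ`, with any constant) applies to only finitely many of them;
* `tight_correspondence_deep_to_deep` : the three files assembled for real identities — for coprime `p, q ∈ ℝ[X]`
  of positive degree `d` whose expensive complex zero count satisfies `D + 1 ≤ d` (the only case in which the
  transferred exponent beats a counterexample exponent, `Negative.toll_bites`), `bal(x) → 0` as `x → 0`.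

So a bounded-degree identity either pays a full degree of junk (`Negative.correspondence_toll`: the bound it
transfers from `H` is trivial) or never brings a deep family into the domain of `H`: the compactly balanced cell is
algebraically isolated from the deep cells, which is the content of the `promote-stub` verdicts on
`stub_balancedToFreySzpiro` (line `birth`).  No `def`s; unconditional; axioms standard.
-/

-- `Summit.<Summit>.<Problem>`: for the single-conjunct summit `ABC` the duplicate `ABC.ABC` is mandated.
set_option linter.dupNamespace false

namespace Summit.ABC.ABC.Theorems.CompactBalanceTransfer.Negative

open Polynomial Filter Topology
open Literature.NumberTheory.DiophantineGeometry

-- The two companion modules are cited by name only (they may be unbuilt on the farm when this file is checked);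
-- the three small facts used from them are re-derived inline below.

/-- **Deep families go to deep families.** If `p·q·(p−q)` vanishes at `0` (the correspondence `p/q` sends the cusp
`0` to a cusp) and `p, q` do not both vanish at `0`, then the balance of the image triple
`(p(x), (q−p)(x), q(x))` tends to `0` as `x → 0`. [folklore] -/
theorem image_balance_tendsto_zero (p q : ℝ[X]) (h0 : (p * q * (p - q)).eval 0 = 0)
    (hne : p.eval 0 ≠ 0 ∨ q.eval 0 ≠ 0) :
    Tendsto (fun x : ℝ => min (min |p.eval x| |q.eval x - p.eval x|) |q.eval x| /
        max (max |p.eval x| |q.eval x - p.eval x|) |q.eval x|) (𝓝 0) (𝓝 0) := by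
  -- numerator and denominator are continuous; their values at `0`
  have hp : Tendsto (fun x : ℝ => p.eval x) (𝓝 0) (𝓝 (p.eval 0)) := p.continuous.tendsto 0
  have hq : Tendsto (fun x : ℝ => q.eval x) (𝓝 0) (𝓝 (q.eval 0)) := q.continuous.tendsto 0
  have hnum : Tendsto (fun x : ℝ => min (min |p.eval x| |q.eval x - p.eval x|) |q.eval x|) (𝓝 0)
      (𝓝 (min (min |p.eval 0| |q.eval 0 - p.eval 0|) |q.eval 0|)) :=
    ((hp.abs).min ((hq.sub hp).abs)).min hq.abs
  have hden : Tendsto (fun x : ℝ => max (max |p.eval x| |q.eval x - p.eval x|) |q.eval x|) (𝓝 0)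
      (𝓝 (max (max |p.eval 0| |q.eval 0 - p.eval 0|) |q.eval 0|)) :=
    ((hp.abs).max ((hq.sub hp).abs)).max hq.abs
  -- the numerator tends to `0`: one of the three members vanishes at `0`
  have hnum0 : min (min |p.eval 0| |q.eval 0 - p.eval 0|) |q.eval 0| = 0 := by
    have h3 : p.eval 0 = 0 ∨ q.eval 0 = 0 ∨ p.eval 0 = q.eval 0 := by
      simpa only [eval_mul, eval_sub, mul_eq_zero, sub_eq_zero, or_assoc] using h0
    have hnn : 0 ≤ min (min |p.eval 0| |q.eval 0 - p.eval 0|) |q.eval 0| :=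
      le_min (le_min (abs_nonneg _) (abs_nonneg _)) (abs_nonneg _)
    refine le_antisymm ?_ hnn
    rcases h3 with h | h | h
    · calc min (min |p.eval 0| |q.eval 0 - p.eval 0|) |q.eval 0| ≤ min |p.eval 0| |q.eval 0 - p.eval 0| :=
            min_le_left _ _
        _ ≤ |p.eval 0| := min_le_left _ _
        _ = 0 := by rw [h, abs_zero]
    · calc min (min |p.eval 0| |q.eval 0 - p.eval 0|) |q.eval 0| ≤ |q.eval 0| := min_le_right _ _
        _ = 0 := by rw [h, abs_zero]
    · calc min (min |p.eval 0| |q.eval 0 - p.eval 0|) |q.eval 0| ≤ min |p.eval 0| |q.eval 0 - p.eval 0| :=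
            min_le_left _ _
        _ ≤ |q.eval 0 - p.eval 0| := min_le_right _ _
        _ = 0 := by rw [h, sub_self, abs_zero]
  -- the denominator tends to a positive limit: `p, q` do not both vanish at `0`
  have hden0 : max (max |p.eval 0| |q.eval 0 - p.eval 0|) |q.eval 0| ≠ 0 := by
    intro h
    have hle : ∀ t : ℝ, t ≤ max (max |p.eval 0| |q.eval 0 - p.eval 0|) |q.eval 0| → 0 ≤ t → t = 0 :=
      fun t ht ht0 => le_antisymm (h ▸ ht) ht0
    have hp0 : |p.eval 0| = 0 := hle _ ((le_max_left _ _).trans (le_max_left _ _)) (abs_nonneg _)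
    have hq0 : |q.eval 0| = 0 := hle _ (le_max_right _ _) (abs_nonneg _)
    rw [abs_eq_zero] at hp0 hq0
    rcases hne with h' | h'
    · exact h' hp0
    · exact h' hq0
  have := hnum.div hden hden0
  rwa [hnum0, zero_div] at this

/-- **`H` never fires on the images.** Under the same hypotheses, for every balance `κ > 0` the images of all
sufficiently deep points are NOT `κ`-balanced: `bal(x) < κ` for `x` near `0`. [folklore] -/
theorem image_eventually_unbalanced (p q : ℝ[X]) (h0 : (p * q * (p - q)).eval 0 = 0)
    (hne : p.eval 0 ≠ 0 ∨ q.eval 0 ≠ 0) {κ : ℝ} (hκ : 0 < κ) :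
    ∀ᶠ x : ℝ in 𝓝 0, min (min |p.eval x| |q.eval x - p.eval x|) |q.eval x| /
        max (max |p.eval x| |q.eval x - p.eval x|) |q.eval x| < κ :=
  (tendsto_order.1 (image_balance_tendsto_zero p q h0 hne)).2 κ hκ

/-- **Lemma NA assembled (real identities): tight correspondences send deep families to deep families.**  For
coprime `p, q ∈ ℝ[X]` with `max (deg p) (deg q) = d ≥ 1` whose number `D` of complex zeros of `p·q·(p−q)` other
than `0, 1` satisfies `D + 1 ≤ d` — by `Negative.correspondence_toll_count` / `Negative.toll_bites` the only
identities that transfer abc-quality — the balance of the image triple tends to `0` with `x = a/c`: no such identity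
moves a deep family into any compactly balanced cell, so the hypothesis `H` of the crux is never brought to bear.
[folklore] -/
theorem tight_correspondence_deep_to_deep {p q : ℝ[X]} (hcop : IsCoprime p q) {d : ℕ}
    (hmax : max p.natDegree q.natDegree = d) (hd : 0 < d)
    (htight : ((((p * q * (p - q)).map (algebraMap ℝ ℂ)).roots.toFinset \ {0, 1}).card) + 1 ≤ d) :
    Tendsto (fun x : ℝ => min (min |p.eval x| |q.eval x - p.eval x|) |q.eval x| /
        max (max |p.eval x| |q.eval x - p.eval x|) |q.eval x|) (𝓝 0) (𝓝 0) := by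
  set f := algebraMap ℝ ℂ with hf
  have hcop' : IsCoprime (p.map f) (q.map f) := (isCoprime_map f).mpr hcop
  have hmax' : max (p.map f).natDegree (q.map f).natDegree = d := by
    rw [natDegree_map, natDegree_map, hmax]
  have hmapf : (p * q * (p - q)).map f = p.map f * q.map f * (p.map f - q.map f) := by
    simp only [Polynomial.map_mul, Polynomial.map_sub]
  rw [hmapf] at htight
  -- `Negative.cusp_preserving_of_tight` (p141369), first component, re-derived: tight ⇒ the product vanishes at 0
  have hN := succ_max_natDegree_le_card_roots hcop' hmax' hd
  have hg0 : p.map f * q.map f * (p.map f - q.map f) ≠ 0 := by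
    intro h
    rw [h, roots_zero, Multiset.toFinset_zero, Finset.card_empty] at hN
    omega
  have hsplit :=
    Finset.card_sdiff_add_card_inter (p.map f * q.map f * (p.map f - q.map f)).roots.toFinset {0, 1}
  have h0C : (p.map f * q.map f * (p.map f - q.map f)).eval 0 = 0 := by
    by_contra h0
    have hsub : (p.map f * q.map f * (p.map f - q.map f)).roots.toFinset ∩ {0, 1} ⊆ {1} := by
      intro x hx
      obtain ⟨hxr, hx01⟩ := Finset.mem_inter.mp hx
      rw [Multiset.mem_toFinset, mem_roots hg0] at hxr
      rcases Finset.mem_insert.mp hx01 with rfl | hx1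
      · exact absurd hxr h0
      · exact hx1
    have hle : ((p.map f * q.map f * (p.map f - q.map f)).roots.toFinset ∩ {0, 1}).card ≤ 1 :=
      (Finset.card_le_card hsub).trans (Finset.card_singleton (1 : ℂ)).le
    omega
  have h0' : (p * q * (p - q)).eval 0 = 0 := by
    rw [← hmapf, eval_zero_map, map_eq_zero_iff f (algebraMap ℝ ℂ).injective] at h0C
    exact h0C
  -- `Negative.eval_ne_zero_or_of_isCoprime` (p141748), re-derived: coprime ⇒ no common zero at 0
  have hne : p.eval 0 ≠ 0 ∨ q.eval 0 ≠ 0 := by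
    obtain ⟨u, v, huv⟩ := hcop
    rcases ne_or_eq (p.eval 0) 0 with hp | hp
    · exact Or.inl hp
    rcases ne_or_eq (q.eval 0) 0 with hq | hq
    · exact Or.inr hq
    have := congrArg (eval 0) huv
    simp only [eval_add, eval_mul, hp, hq, mul_zero, add_zero, eval_one] at this
    exact absurd this zero_ne_one
  exact image_balance_tendsto_zero p q h0' hne

end Summit.ABC.ABC.Theorems.CompactBalanceTransfer.Negative
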